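import Literature.Geometry.Lorentzian.KerrWaveEnergyProofs
import Literature.Geometry.Lorentzian.KerrTimelikeSpan
import Mathlib.Analysis.InnerProductSpace.Dual
import HarnessLib

/-!
# The far-region `J^T` energy identity for the Kerr wave equation with general margins:
# discharge of `kerr_far_TEnergy_comparison`

(family `gr`, statement **gr.S24** infrastructure; trunk G08 = T-LORENTZ)

`KerrWaveEnergy.lean` vendors the named fact `Literature.Geometry.Lorentzian.kerr_far_TEnergy_comparison`
(the `J^T` energy identity between two graph hypersurfaces `{t* = τ + F_i(y)}` of the ingoing
Kerr–Schild chart which agree near the black hole, in the far region where `T = ∂_{t*}` is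
timelike; Dafermos–Rodnianski–Shlapentokh-Rothman arXiv:1402.7034, §2.3.2 with `V = T`, §2.2.2,
§3.1), and `KerrWaveEnergyProofs.lean` proves its *perturbative* special case
`kerr_far_TEnergy_comparison_of_farRadius_le` (`R' ≥ R_far(M, a)`, slopes `≤ 1/4`, `2H ≤ 1/72`,
constant `8`). This file proves the fact **as stated**, for general margins:

* `Literature.Geometry.Lorentzian.kerr_far_TEnergy_comparison_holds : kerr_far_TEnergy_comparison` — for subextremal
  `(M, a)`, `c > 0`, two `C^∞` heights `F₁ ≤ F₂` with slopes `≤ 1 − c` agreeing on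
  `{‖y‖ ≤ R'}`, `{‖y‖ > R'}` inside the exterior slice and `2H ≤ 1 − c` at the exterior points
  with `‖x⃗‖ ≥ R'`, the far energies of every smooth solution vanishing (with its differential)
  on the far part of the wedge between the graphs satisfy `E^far_{F₂}(τ) ≤ C E^far_{F₁}(τ)`,
  `E^far_{F₁}(τ) ≤ C E^far_{F₂}(τ)` with `C = (6/c)(7/2) = 21/c`.

The proof is that of the perturbative case (differentiation of the flux through the graphs of
`F₁ + κ(θ)(F₂ − F₁)` under the integral sign, `Kerr.graphFluxDeriv_eq`, the coordinate
conservation law `Kerr.sum_fderiv_tCurrent_eq_zero` and integration by parts on `E3` — DRSR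
§2.3.2 in differential form), with three new ingredients:

* `Kerr.fluxQuad_kerrSchild_eq`, `Kerr.fluxQuad_kerrSchild_bounds`,
  `Kerr.graphFluxDensity_bounds_of_le` — **the pointwise comparability with general margins**
  (DRSR §3.1, display after (23): `J^T_μ n^μ ∼ ∑(∂ψ)²`). For `g^{μν} = η^{μν} − 2H ℓ^μ ℓ^ν`,
  `ℓ = (−1, ℓ⃗)♯`, `|ℓ⃗| = 1`, and the conormal `n = dt* − dF = (1, n⃗)` one has the completed-
  squares identity `2f = |p⃗ − p₀n⃗|² + (1 − |n⃗|²)p₀² + 2H[(1 − ℓ⃗·n⃗)²p₀² − (ℓ⃗·(p⃗ − p₀n⃗))²]`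
  (`p = dΦ`), whence `(c/6)∑p_μ² ≤ f ≤ (7/2)∑p_μ²` when `2H ≤ 1 − c` and `|n⃗|² ≤ 1 − c`
  (Cauchy–Schwarz `(ℓ⃗·w⃗)² ≤ |w⃗|²`); regrouped, `2f = −g⁻¹(n, n) p₀² + (|w⃗|² − 2H(ℓ⃗·w⃗)²)`
  with `w⃗ = p⃗ − p₀n⃗`, both terms nonnegative — the dominant energy condition `𝐓(T, −g♯n) ≥ 0`
  made quantitative in coordinates.
* `Kerr.sum_sq_partialE3_eq` — `∑_i (∂_iF)² = ‖dF‖²` (Riesz representation in Euclidean `ℝ³`),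
  so that a slope `‖dF‖ ≤ 1 − c` gives `|n⃗|² ≤ (1 − c)² ≤ 1 − c` (`Kerr.graphConormal_sq_le_of_le`;
  the perturbative file only used `|∂_iF| ≤ ‖dF‖`).
* `Kerr.mem_slice_of_le_norm_of_two_mul_scalarH_le` — **the closed far region `{‖y‖ ≥ R'}` lies
  in the exterior slice** under the hypotheses of the fact: a boundary point is a limit of far
  points, so `r ≥ r₊` there, and `r = r₊` is excluded because on the horizon
  `2H = 2Mr₊³/(r₊⁴ + a²z²) ≥ 2Mr₊/(r₊² + a²) = 1` (`Kerr.one_le_two_mul_scalarH_of_radius_eq_rPlus`,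
  from `z² ≤ r²`, `Kerr.sq_apply_three_le_radius_sq` of `KerrTimelikeSpan.lean`, and
  `Δ(r₊) = 0`) while `2H ≤ 1 − c` nearby (continuity of `H`, `ContinuousWithinAt.closure_le`).
  This replaces the explicit far radius `R_af + 1` of the perturbative case; the open set
  carrying the integration by parts is the slice `{r(0, ·) > r₊}` itself.

Nothing here changes a statement: the fact keeps its vendored form in `KerrWaveEnergy.lean` and
is discharged verbatim (D-0014).

## References

* M. Dafermos, I. Rodnianski, Y. Shlapentokh-Rothman, *Decay for solutions of the wave equation
  on Kerr exterior spacetimes III: the full subextremal case `|a| < M`*, Ann. of Math. 183 (2016)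
  787–913, arXiv:1402.7034: §2.2.2 (`T` Killing; `T` timelike off the ergoregion), §2.2.4 (the
  ergoregion), §2.3.1–§2.3.2 (`J^V`, `K^V`, `𝓔^V`, the divergence identity
  `∫_{S⁺} J^V_μ n^μ + ∫_𝓑 (K^V + 𝓔^V) = ∫_{S⁻} J^V_μ n^μ`), §3.1 (display after (23):
  `∫ J^N_μ n^μ ∼ ∫ |∂_{t*}ψ|² + |∂_rψ|² + |∇̸ψ|²`) (key `DafermosRodnianskiShlapentokhrothman2014`).
* M. Dafermos, I. Rodnianski, *Lectures on black holes and linear waves*, arXiv:0811.0354,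
  App. D (key `DafermosRodnianski2008`).
* M. Visser, *The Kerr spacetime: a brief introduction*, arXiv:0706.0622, (33)–(35)
  (key `arXiv07060622`).
-/

noncomputable section

open Set Filter
open scoped ContDiff Topology Manifold ENNReal

namespace Literature.Geometry.Lorentzian

namespace Kerr

/-! ### The flux density of `∂_{t*}` through a graph, for a Kerr–Schild inverse metric: exact
formula and two-sided bounds with general margins -/

section Algebra

/-- **The `∂_{t*}`-flux density for a Kerr–Schild inverse metric, completed squares.** For
`g^{μν} = η^{μν} − h ℓ^μ ℓ^ν` with `ℓ⁰ = −1` and a conormal `n = (1, n⃗)`, writing `p⃗` for the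
spatial part of `p` and `w⃗ = p⃗ − p₀ n⃗`,
`2·fluxQuad g p n = |w⃗|² + (1 − |n⃗|²) p₀² + h [(1 − ℓ⃗·n⃗)² p₀² − (ℓ⃗·w⃗)²]`
(a polynomial identity; for `h = 0` it is the flat `½(p₀² + |p⃗|²) − p₀ (n⃗·p⃗)` of
`Kerr.fluxQuad_etaComp`; regrouped, `2·fluxQuad = −g⁻¹(n, n) p₀² + (|w⃗|² − h(ℓ⃗·w⃗)²)` since
`g⁻¹(n, n) = −1 + |n⃗|² − h(1 − ℓ⃗·n⃗)²`). This is `−J^T_μ n^μ`-bookkeeping for `g = η + 2Hℓ⊗ℓ`,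
`T = ∂_{t*}` (DRSR arXiv:1402.7034, §2.3.1–§2.3.2) in Kerr–Schild components. [folklore] -/
theorem fluxQuad_kerrSchild_eq (h : ℝ) (ℓ p n : Fin 4 → ℝ) (hℓ0 : ℓ 0 = -1) (hn0 : n 0 = 1) :
    fluxQuad (fun μ ν ↦ etaComp μ ν - h * ℓ ν * ℓ μ) p n =
      2⁻¹ * (((p 1 - p 0 * n 1) ^ 2 + (p 2 - p 0 * n 2) ^ 2 + (p 3 - p 0 * n 3) ^ 2) +
        (1 - (n 1 ^ 2 + n 2 ^ 2 + n 3 ^ 2)) * p 0 ^ 2 +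
        h * ((1 - (ℓ 1 * n 1 + ℓ 2 * n 2 + ℓ 3 * n 3)) ^ 2 * p 0 ^ 2 -
          (ℓ 1 * (p 1 - p 0 * n 1) + ℓ 2 * (p 2 - p 0 * n 2) + ℓ 3 * (p 3 - p 0 * n 3)) ^ 2)) := by
  simp only [fluxQuad, etaComp, Fin.sum_univ_four, Fin.isValue, if_true,
    show (1 : Fin 4) ≠ 0 from by decide, show (2 : Fin 4) ≠ 0 from by decide,
    show (3 : Fin 4) ≠ 0 from by decide, show (0 : Fin 4) ≠ 1 from by decide,
    show (0 : Fin 4) ≠ 2 from by decide, show (0 : Fin 4) ≠ 3 from by decide,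
    show (1 : Fin 4) ≠ 2 from by decide, show (1 : Fin 4) ≠ 3 from by decide,
    show (2 : Fin 4) ≠ 1 from by decide, show (2 : Fin 4) ≠ 3 from by decide,
    show (3 : Fin 4) ≠ 1 from by decide, show (3 : Fin 4) ≠ 2 from by decide, if_false, hℓ0, hn0]
  ring

/-- Cauchy–Schwarz in `ℝ³`, polynomial form (Lagrange's identity). [folklore] -/
theorem sq_dot_le_three (a₁ a₂ a₃ b₁ b₂ b₃ : ℝ) :
    (a₁ * b₁ + a₂ * b₂ + a₃ * b₃) ^ 2 ≤
      (a₁ ^ 2 + a₂ ^ 2 + a₃ ^ 2) * (b₁ ^ 2 + b₂ ^ 2 + b₃ ^ 2) := by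
  nlinarith [sq_nonneg (a₁ * b₂ - a₂ * b₁), sq_nonneg (a₁ * b₃ - a₃ * b₁),
    sq_nonneg (a₂ * b₃ - a₃ * b₂)]

/-- The completed-squares form of `Kerr.fluxQuad_kerrSchild_eq`, bounded on both sides by the
coordinate square sum: in the variables `p₀`, `w⃗ = p⃗ − p₀n⃗` (so `p⃗ = w⃗ + p₀n⃗`), for
`|ℓ⃗|² = 1`, `0 ≤ h ≤ 1 − c`, `|n⃗|² ≤ 1 − c`, `0 < c`,
`(c/6) P ≤ ½(|w⃗|² + (1−|n⃗|²)p₀² + h[(1 − ℓ⃗·n⃗)²p₀² − (ℓ⃗·w⃗)²]) ≤ (7/2) P` with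
`P = p₀² + |w⃗ + p₀n⃗|²`. Elementary (`(ℓ⃗·w⃗)² ≤ |w⃗|²`, `|ℓ⃗·n⃗| ≤ 1`). [folklore] -/
theorem fluxQuad_kerrSchild_aux (c h p₀ w₁ w₂ w₃ n₁ n₂ n₃ l₁ l₂ l₃ : ℝ) (hc : 0 < c)
    (hh0 : 0 ≤ h) (hh : h ≤ 1 - c) (hl : l₁ ^ 2 + l₂ ^ 2 + l₃ ^ 2 = 1)
    (hn : n₁ ^ 2 + n₂ ^ 2 + n₃ ^ 2 ≤ 1 - c) :
    c / 6 * (p₀ ^ 2 + (w₁ + p₀ * n₁) ^ 2 + (w₂ + p₀ * n₂) ^ 2 + (w₃ + p₀ * n₃) ^ 2) ≤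
        2⁻¹ * ((w₁ ^ 2 + w₂ ^ 2 + w₃ ^ 2) + (1 - (n₁ ^ 2 + n₂ ^ 2 + n₃ ^ 2)) * p₀ ^ 2 +
          h * ((1 - (l₁ * n₁ + l₂ * n₂ + l₃ * n₃)) ^ 2 * p₀ ^ 2 -
            (l₁ * w₁ + l₂ * w₂ + l₃ * w₃) ^ 2)) ∧
      2⁻¹ * ((w₁ ^ 2 + w₂ ^ 2 + w₃ ^ 2) + (1 - (n₁ ^ 2 + n₂ ^ 2 + n₃ ^ 2)) * p₀ ^ 2 +
          h * ((1 - (l₁ * n₁ + l₂ * n₂ + l₃ * n₃)) ^ 2 * p₀ ^ 2 -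
            (l₁ * w₁ + l₂ * w₂ + l₃ * w₃) ^ 2)) ≤
        7 / 2 * (p₀ ^ 2 + (w₁ + p₀ * n₁) ^ 2 + (w₂ + p₀ * n₂) ^ 2 + (w₃ + p₀ * n₃) ^ 2) := by
  -- names for the recurring quantities
  obtain ⟨W, hW⟩ : ∃ W : ℝ, W = w₁ ^ 2 + w₂ ^ 2 + w₃ ^ 2 := ⟨_, rfl⟩
  obtain ⟨N, hN⟩ : ∃ N : ℝ, N = n₁ ^ 2 + n₂ ^ 2 + n₃ ^ 2 := ⟨_, rfl⟩
  obtain ⟨S, hS⟩ : ∃ S : ℝ, S = l₁ * w₁ + l₂ * w₂ + l₃ * w₃ := ⟨_, rfl⟩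
  obtain ⟨L, hL⟩ : ∃ L : ℝ, L = l₁ * n₁ + l₂ * n₂ + l₃ * n₃ := ⟨_, rfl⟩
  obtain ⟨P, hP⟩ : ∃ P : ℝ,
      P = p₀ ^ 2 + (w₁ + p₀ * n₁) ^ 2 + (w₂ + p₀ * n₂) ^ 2 + (w₃ + p₀ * n₃) ^ 2 := ⟨_, rfl⟩
  rw [← hW, ← hN, ← hS, ← hL, ← hP]
  have hW0 : 0 ≤ W := by rw [hW]; positivity
  have hN0 : 0 ≤ N := by rw [hN]; positivity
  have hN1 : N ≤ 1 := by rw [hN]; linarith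
  have hp0 : 0 ≤ p₀ ^ 2 := sq_nonneg _
  -- Cauchy–Schwarz
  have hSW : S ^ 2 ≤ W := by
    have := sq_dot_le_three l₁ l₂ l₃ w₁ w₂ w₃
    rw [hl, one_mul] at this
    rwa [hS, hW]
  have hL1 : L ^ 2 ≤ 1 := by
    have := sq_dot_le_three l₁ l₂ l₃ n₁ n₂ n₃
    rw [hl, one_mul] at this
    rw [hL]
    linarith
  have hL4 : (1 - L) ^ 2 ≤ 4 := by
    have hab : |L| ≤ 1 := abs_le_one_iff_mul_self_le_one.mpr (by linarith [hL1])
    have := abs_le.mp hab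
    linarith [this.1, this.2, hL1]
  -- `P ≤ 3 p₀² + 2 W` and `W ≤ 2 P`
  have hpN : p₀ ^ 2 * N ≤ p₀ ^ 2 := mul_le_of_le_one_right hp0 hN1
  have hPW : P ≤ p₀ ^ 2 + 2 * W + 2 * p₀ ^ 2 * N := by
    rw [hP, hW, hN]
    linarith [sq_nonneg (w₁ - p₀ * n₁), sq_nonneg (w₂ - p₀ * n₂), sq_nonneg (w₃ - p₀ * n₃)]
  have hPW' : P ≤ 3 * p₀ ^ 2 + 2 * W := by linarith
  have hWP : W ≤ 2 * (P - p₀ ^ 2) + 2 * p₀ ^ 2 * N := by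
    rw [hP, hW, hN]
    linarith [sq_nonneg (w₁ + 2 * p₀ * n₁), sq_nonneg (w₂ + 2 * p₀ * n₂),
      sq_nonneg (w₃ + 2 * p₀ * n₃)]
  have hWP' : W ≤ 2 * P := by linarith
  have hPp : p₀ ^ 2 ≤ P := by
    rw [hP]
    linarith [sq_nonneg (w₁ + p₀ * n₁), sq_nonneg (w₂ + p₀ * n₂), sq_nonneg (w₃ + p₀ * n₃)]
  constructor
  · -- lower bound
    have ha : h * S ^ 2 ≤ h * W := mul_le_mul_of_nonneg_left hSW hh0
    have hb : 0 ≤ h * ((1 - L) ^ 2 * p₀ ^ 2) := by positivity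
    have hcW : c * W ≤ (1 - h) * W := mul_le_mul_of_nonneg_right (by linarith) hW0
    have hcp : c * p₀ ^ 2 ≤ (1 - N) * p₀ ^ 2 := mul_le_mul_of_nonneg_right (by linarith) hp0
    have hcW0 : 0 ≤ c * W := by positivity
    have hcP : c * P ≤ c * (3 * p₀ ^ 2 + 2 * W) := mul_le_mul_of_nonneg_left hPW' hc.le
    linarith
  · -- upper bound
    have hh1 : h ≤ 1 := by linarith
    have ha : h * ((1 - L) ^ 2 * p₀ ^ 2) ≤ 1 * (4 * p₀ ^ 2) :=
      mul_le_mul hh1 (mul_le_mul_of_nonneg_right hL4 hp0) (by positivity) zero_le_one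
    have hb : 0 ≤ h * S ^ 2 := by positivity
    have hcc : (1 - N) * p₀ ^ 2 ≤ p₀ ^ 2 := by
      have := mul_nonneg hN0 hp0
      linarith
    linarith

/-- **Two-sided bound for the `∂_{t*}`-flux density with general margins.** For
`g^{μν} = η^{μν} − h ℓ^μ ℓ^ν` with `ℓ⁰ = −1`, `|ℓ⃗|² = 1`, `0 ≤ h ≤ 1 − c`, and a conormal
`n = (1, n⃗)` with `|n⃗|² ≤ 1 − c`, `0 < c`: `(c/6) ∑ p_μ² ≤ fluxQuad g p n ≤ (7/2) ∑ p_μ²`.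
From `Kerr.fluxQuad_kerrSchild_eq`: `(ℓ⃗·w⃗)² ≤ |w⃗|²` (Cauchy–Schwarz), so
`2·fluxQuad ≥ (1 − h)|w⃗|² + (1 − |n⃗|²)p₀² ≥ c(|w⃗|² + p₀²)` and `∑p² ≤ 3p₀² + 2|w⃗|²`; above,
`2·fluxQuad ≤ |w⃗|² + p₀² + 4p₀² ≤ 7∑p²`. This is the quantitative form of the comparability
`J^T_μ n^μ ∼ ∑(∂ψ)²` (DRSR arXiv:1402.7034, §3.1, display after (23)) wherever `T` is timelike
with margin `g(T,T) = −1 + h ≤ −c` and the graph is spacelike with margin. [folklore] -/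
theorem fluxQuad_kerrSchild_bounds (h : ℝ) (ℓ p n : Fin 4 → ℝ) {c : ℝ} (hc : 0 < c)
    (hh0 : 0 ≤ h) (hh : h ≤ 1 - c) (hℓ0 : ℓ 0 = -1) (hℓ : ℓ 1 ^ 2 + ℓ 2 ^ 2 + ℓ 3 ^ 2 = 1)
    (hn0 : n 0 = 1) (hn : n 1 ^ 2 + n 2 ^ 2 + n 3 ^ 2 ≤ 1 - c) :
    c / 6 * ∑ μ, p μ ^ 2 ≤ fluxQuad (fun μ ν ↦ etaComp μ ν - h * ℓ ν * ℓ μ) p n ∧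
      fluxQuad (fun μ ν ↦ etaComp μ ν - h * ℓ ν * ℓ μ) p n ≤ 7 / 2 * ∑ μ, p μ ^ 2 := by
  rw [fluxQuad_kerrSchild_eq h ℓ p n hℓ0 hn0, Fin.sum_univ_four]
  have key := fluxQuad_kerrSchild_aux c h (p 0) (p 1 - p 0 * n 1) (p 2 - p 0 * n 2)
    (p 3 - p 0 * n 3) (n 1) (n 2) (n 3) (ℓ 1) (ℓ 2) (ℓ 3) hc hh0 hh hℓ hn
  have e : p 0 ^ 2 + (p 1 - p 0 * n 1 + p 0 * n 1) ^ 2 + (p 2 - p 0 * n 2 + p 0 * n 2) ^ 2 +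
      (p 3 - p 0 * n 3 + p 0 * n 3) ^ 2 = p 0 ^ 2 + p 1 ^ 2 + p 2 ^ 2 + p 3 ^ 2 := by ring
  rw [e] at key
  exact key

end Algebra

/-! ### The slope of a height function and the conormal of its graph -/

/-- **The coordinate partial derivatives of a function on `E3` have square sum `‖dF‖²`**: the
operator norm of a functional on Euclidean `ℝ³` is the Euclidean norm of its Riesz representative
(`InnerProductSpace.toDual`), whose coordinates are the values on the standard basis. [folklore] -/
theorem sum_sq_partialE3_eq (F : E3 → ℝ) (y : E3) :
    ∑ i, partialE3 F y i ^ 2 = ‖fderiv ℝ F y‖ ^ 2 := by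
  set v : E3 := (InnerProductSpace.toDual ℝ E3).symm (fderiv ℝ F y) with hv
  have hvi : ∀ i, v i = partialE3 F y i := by
    intro i
    have h1 : inner ℝ v (EuclideanSpace.single i (1 : ℝ)) =
        fderiv ℝ F y (EuclideanSpace.single i 1) :=
      InnerProductSpace.toDual_symm_apply
    rw [EuclideanSpace.inner_single_right] at h1
    simp only [one_mul, conj_trivial] at h1
    rw [partialE3, ← h1]
  have hnorm : ‖v‖ = ‖fderiv ℝ F y‖ := by rw [hv, LinearIsometryEquiv.norm_map]
  rw [← hnorm, EuclideanSpace.real_norm_sq_eq]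
  exact Finset.sum_congr rfl fun i _ ↦ by rw [hvi]

/-- Slope `‖dF‖ ≤ 1 − c` (`0 < c`) gives `n₁² + n₂² + n₃² ≤ (1 − c)² ≤ 1 − c` for the graph
conormal `n = (1, −∂₁F, −∂₂F, −∂₃F)`. [folklore] -/
theorem graphConormal_sq_le_of_le (F : E3 → ℝ) (y : E3) {c : ℝ} (hc : 0 < c)
    (hF : ‖fderiv ℝ F y‖ ≤ 1 - c) :
    graphConormal F y 1 ^ 2 + graphConormal F y 2 ^ 2 + graphConormal F y 3 ^ 2 ≤ 1 - c := by
  have e1 : graphConormal F y 1 = -partialE3 F y 0 := rfl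
  have e2 : graphConormal F y 2 = -partialE3 F y 1 := rfl
  have e3 : graphConormal F y 3 = -partialE3 F y 2 := rfl
  rw [e1, e2, e3, neg_sq, neg_sq, neg_sq]
  have hsum := sum_sq_partialE3_eq F y
  rw [Fin.sum_univ_three] at hsum
  rw [hsum]
  have h0 : 0 ≤ ‖fderiv ℝ F y‖ := norm_nonneg _
  have h1 : ‖fderiv ℝ F y‖ ^ 2 ≤ (1 - c) ^ 2 := pow_le_pow_left₀ h0 hF 2
  have h2 : (1 - c) ^ 2 ≤ 1 - c := pow_le_of_le_one (h0.trans hF) (by linarith) two_ne_zero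
  exact h1.trans h2

/-- **Two-sided comparison of the graph flux density with the coordinate energy density, with
general margins**: at a graph point with `r > 0` where `2H ≤ 1 − c` (`T = ∂_{t*}` timelike with
margin, `g(∂_{t*}, ∂_{t*}) = −1 + 2H ≤ −c`), for `M ≥ 0` and a slope `‖dF(y)‖ ≤ 1 − c` (the
graph spacelike with margin), `(c/6) ∑_μ (∂_μΦ)² ≤ f_F(τ, y) ≤ (7/2) ∑_μ (∂_μΦ)²`. This is the
comparability `J^T_μ n^μ ∼ ∑(∂ψ)²` of DRSR arXiv:1402.7034, §3.1 (display after (23)), with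
constants depending only on the margin `c`. [folklore] -/
theorem graphFluxDensity_bounds_of_le {M : ℝ} (hM : 0 ≤ M) (a : ℝ) (F : E3 → ℝ) (Φ : E4 → ℝ)
    (τ : ℝ) (y : E3) {c : ℝ} (hc : 0 < c) (hr : 0 < radius a (E4.ofTimeSpace (τ + F y) y))
    (hH : 2 * scalarH M a (E4.ofTimeSpace (τ + F y) y) ≤ 1 - c) (hF : ‖fderiv ℝ F y‖ ≤ 1 - c) :
    c / 6 * ∑ μ, (fderiv ℝ Φ (E4.ofTimeSpace (τ + F y) y) (E4.basisVector μ)) ^ 2 ≤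
        graphFluxDensity M a F Φ τ y ∧
      graphFluxDensity M a F Φ τ y ≤
        7 / 2 * ∑ μ, (fderiv ℝ Φ (E4.ofTimeSpace (τ + F y) y) (E4.basisVector μ)) ^ 2 := by
  set x : E4 := E4.ofTimeSpace (τ + F y) y with hx
  unfold graphFluxDensity
  rw [neg_sum_tCurrent_mul]
  have hg : inverseMetric M a x =
      fun μ ν ↦ etaComp μ ν - 2 * scalarH M a x * nullVector a x ν * nullVector a x μ := by
    funext μ ν
    rw [inverseMetric_apply, etaComp]
  rw [hg]
  exact fluxQuad_kerrSchild_bounds (2 * scalarH M a x) (fun μ ↦ nullVector a x μ) _ _ hc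
    (by linarith [scalarH_nonneg hM a x]) hH (nullVector_apply_zero a x)
    (by rw [nullVector_apply_one, nullVector_apply_two, nullVector_apply_three]
        exact sum_sq_nullCovectorFun hr)
    rfl (graphConormal_sq_le_of_le F y hc hF)

/-! ### The closed far region lies in the exterior slice -/

/-- **`∂_{t*}` is not timelike on the event horizon**: at a point with `r = r₊` (subextremal
parameters) `2H = 2Mr₊³/(r₊⁴ + a²z²) ≥ 2Mr₊³/(r₊⁴ + a²r₊²) = 2Mr₊/(r₊² + a²) = 1`, i.e.
`g(∂_{t*}, ∂_{t*}) = −1 + 2H ≥ 0` (the horizon lies in the closure of the ergoregion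
`{r² + a²cos²θ < 2Mr}`; O'Neill 1995, Ch. 2, §2.4; DRSR arXiv:1402.7034, §2.2.4). [folklore] -/
theorem one_le_two_mul_scalarH_of_radius_eq_rPlus {M a : ℝ} (hMa : IsSubextremal M a) {x : E4}
    (hx : radius a x = rPlus M a) : 1 ≤ 2 * scalarH M a x := by
  have hr : 0 < radius a x := by rw [hx]; exact hMa.rPlus_pos
  have hz := sq_apply_three_le_radius_sq a hr
  have hhor : radius a x ^ 2 + a ^ 2 = 2 * M * radius a x := by
    rw [hx]; linarith [hMa.rPlus_sq]
  have hden : 0 < radius a x ^ 4 + a ^ 2 * x 3 ^ 2 := by positivity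
  unfold scalarH
  rw [← mul_div_assoc, le_div_iff₀ hden, one_mul]
  have h1 : a ^ 2 * x 3 ^ 2 ≤ a ^ 2 * radius a x ^ 2 := mul_le_mul_of_nonneg_left hz (sq_nonneg a)
  calc radius a x ^ 4 + a ^ 2 * x 3 ^ 2 ≤ radius a x ^ 4 + a ^ 2 * radius a x ^ 2 := by linarith
    _ = radius a x ^ 2 * (radius a x ^ 2 + a ^ 2) := by ring
    _ = radius a x ^ 2 * (2 * M * radius a x) := by rw [hhor]
    _ = 2 * (M * radius a x ^ 3) := by ring

/-- **The closed far region lies in the exterior slice.** If the open far region `{‖y‖ > R}`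
lies in the slice `{r > r₊}` and `2H ≤ 1 − c < 1` at all exterior points with `‖x⃗‖ ≥ R`
(the hypotheses of `kerr_far_TEnergy_comparison`: `∂_{t*}` uniformly timelike on the far
exterior), then also the sphere `{‖y‖ = R}` lies in the slice: a point `y` of the closed region
is a limit of points of the open one, so `r(y) ≥ r₊` and, `H` being continuous at `y`
(`r(y) > 0`), `2H(y) ≤ 1 − c`; but `r(y) = r₊` would give `2H(y) ≥ 1`
(`Kerr.one_le_two_mul_scalarH_of_radius_eq_rPlus`). In particular the far region stays away
from the ergoregion and the horizon (DRSR arXiv:1402.7034, §2.2.4). [folklore] -/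
theorem mem_slice_of_le_norm_of_two_mul_scalarH_le {M a R c : ℝ} (hMa : IsSubextremal M a)
    (hc : 0 < c) (hslice : ∀ y : E3, R < ‖y‖ → y ∈ slice a (rPlus M a))
    (hH : ∀ x : E4, x ∈ exterior M a → R ≤ E4.spatialNorm x → 2 * scalarH M a x ≤ 1 - c)
    {y : E3} (hy : R ≤ ‖y‖) : y ∈ slice a (rPlus M a) := by
  -- `y` is in the closure of the open far region `A`
  set A : Set E3 := {y | R < ‖y‖} with hA_def
  have hyA : y ∈ closure A := by
    have hA : A = (Metric.closedBall (0 : E3) R)ᶜ := by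
      ext z
      simp [hA_def, Metric.mem_closedBall, dist_zero_right, not_le]
    rw [hA, closure_compl, interior_closedBall' (0 : E3) R, Set.mem_compl_iff, Metric.mem_ball,
      dist_zero_right, not_lt]
    exact hy
  have hrp : 0 < rPlus M a := hMa.rPlus_pos
  have hmax : max (rPlus M a) 0 = rPlus M a := max_eq_left hrp.le
  -- `r(0, y) ≥ r₊` by continuity of the radius
  have hrc : Continuous fun z : E3 ↦ radius a (E4.ofTimeSpace 0 z) :=
    (continuous_radius a).comp (E4.continuous_ofTimeSpace 0)
  have hAsub : A ⊆ {z : E3 | rPlus M a < radius a (E4.ofTimeSpace 0 z)} := fun z hz ↦ by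
    have := hslice z hz
    rwa [mem_slice, hmax] at this
  have hge : rPlus M a ≤ radius a (E4.ofTimeSpace 0 y) :=
    closure_lt_subset_le continuous_const hrc (closure_mono hAsub hyA)
  -- if `r(0, y) = r₊` then `2H ≥ 1` there, contradicting `2H ≤ 1 − c` by continuity of `H`
  by_contra hnot
  rw [mem_slice, hmax, not_lt] at hnot
  have heq : radius a (E4.ofTimeSpace 0 y) = rPlus M a := le_antisymm hnot hge
  have h1 : 1 ≤ 2 * scalarH M a (E4.ofTimeSpace 0 y) :=
    one_le_two_mul_scalarH_of_radius_eq_rPlus hMa heq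
  have hpos : 0 < radius a (E4.ofTimeSpace 0 y) := by rw [heq]; exact hrp
  have hcont : ContinuousWithinAt (fun z : E3 ↦ 2 * scalarH M a (E4.ofTimeSpace 0 z)) A y := by
    refine (continuousAt_const.mul ?_).continuousWithinAt
    exact (contDiffAt_scalarH M a hpos (n := 0)).continuousAt.comp
      (E4.continuous_ofTimeSpace 0).continuousAt
  have hle : 2 * scalarH M a (E4.ofTimeSpace 0 y) ≤ 1 - c := by
    refine hcont.closure_le hyA continuousWithinAt_const fun z hz ↦ ?_
    refine hH _ (ofTimeSpace_mem_exterior_iff.mpr (hslice z hz)) ?_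
    rw [E4.spatialNorm_ofTimeSpace]
    exact le_of_lt hz
  linarith

end Kerr

open MeasureTheory

/-! ### The far-region `J^T` energy identity with general margins -/

/-- **The `J^T` energy identity in the far region: proof of the named fact
`kerr_far_TEnergy_comparison`** (`KerrWaveEnergy.lean`). Let `(M, a)` be subextremal,
`F₁ ≤ F₂` two `C^∞` height functions with slopes `≤ 1 − c`, `c > 0`, which coincide on
`{‖y‖ ≤ R'}`, such that `{‖y‖ > R'}` lies in the exterior slice and `2H ≤ 1 − c`
(`g(∂_{t*}, ∂_{t*}) ≤ −c`) at the exterior points with `‖x⃗‖ ≥ R'`. Then with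
`C = (6/c)·(7/2) = 21/c`, for every smooth solution `ψ` of `□_g ψ = 0` on the exterior and every
`τ` such that `ψ, dψ` vanish on the wedge `{τ + F₁(x⃗) ≤ x⁰ ≤ τ + F₂(x⃗), ‖x⃗‖ ≥ ρ}` for some
`ρ`, the coordinate energies through the far parts `{‖y‖ > R'}` of the graphs `{t* = τ + F_i}`
satisfy `E^far_{F₂}(τ) ≤ C E^far_{F₁}(τ)` and `E^far_{F₁}(τ) ≤ C E^far_{F₂}(τ)`.
Proof: that of `kerr_far_TEnergy_comparison_of_farRadius_le` (Dafermos–Rodnianski–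
Shlapentokh-Rothman arXiv:1402.7034, §2.3.2: the divergence identity with `V = T`, `K^T = 0`
since `T` is Killing (§2.2.2), `𝓔^T = 0` for solutions, in differential form along the family of
graphs of `F₁ + κ(θ)(F₂ − F₁)`: `Kerr.graphFluxDeriv_eq`, `Kerr.sum_fderiv_tCurrent_eq_zero`,
integration by parts on `E3`, differentiation under the integral sign), with three changes:
the pointwise comparability `(c/6)∑(∂Φ)² ≤ f_F ≤ (7/2)∑(∂Φ)²` with general margins
(`Kerr.graphFluxDensity_bounds_of_le`, from the completed-squares formula
`Kerr.fluxQuad_kerrSchild_eq` and the sharp slope bound `Kerr.sum_sq_partialE3_eq`; DRSR §3.1,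
display after (23)); the closed far region `{‖y‖ ≥ R'}` lies in the slice
(`Kerr.mem_slice_of_le_norm_of_two_mul_scalarH_le`, from the hypothesis `2H ≤ 1 − c`: on the
horizon `2H ≥ 1`); and the open set carrying the integration by parts is the slice itself.
[cite: DafermosRodnianskiShlapentokhrothman2014, §2.3.2 (divergence identity, V = T), §2.2.2, §3.1 display after (23)] -/
theorem kerr_far_TEnergy_comparison_holds : kerr_far_TEnergy_comparison := by
  intro instF instS M a hMa F₁ F₂ R' c hc hF₁' hF₂' hdF₁ hdF₂ hagree hle hsliceR hHR
  classical
  have hM : 0 < M := hMa.pos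
  have hF₁ : ContDiff ℝ 1 F₁ := hF₁'.of_le (ENat.natCast_le_of_coe_top_le_withTop le_rfl 1)
  have hF₂ : ContDiff ℝ 1 F₂ := hF₂'.of_le (ENat.natCast_le_of_coe_top_le_withTop le_rfl 1)
  -- ### geometry of the far region (from the margin hypotheses)
  have hmemU : ∀ (t : ℝ) (y : E3), R' ≤ ‖y‖ → E4.ofTimeSpace t y ∈ (Kerr.exterior M a) :=
    fun t y hy ↦ Kerr.ofTimeSpace_mem_exterior_iff.mpr
      (Kerr.mem_slice_of_le_norm_of_two_mul_scalarH_le hMa hc hsliceR hHR hy)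
  have hUr : ∀ x ∈ ((Kerr.exterior M a) : Set E4), 0 < Kerr.radius a x := fun x hx ↦
    Kerr.radius_pos_of_mem_region hx
  have hH : ∀ (t : ℝ) (y : E3), R' ≤ ‖y‖ →
      2 * Kerr.scalarH M a (E4.ofTimeSpace t y) ≤ 1 - c := fun t y hy ↦
    hHR _ (hmemU t y hy) (by rw [E4.spatialNorm_ofTimeSpace]; exact hy)
  -- ### the constant `C = (6/c)·(7/2)`
  set K₁ : ℝ≥0∞ := ENNReal.ofReal (6 / c) with hK₁
  set K₂ : ℝ≥0∞ := ENNReal.ofReal (7 / 2) with hK₂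
  refine ⟨K₁ * K₂, ENNReal.mul_lt_top ENNReal.ofReal_lt_top ENNReal.ofReal_lt_top,
    fun ψ τ hψ hsol hvan ↦ ?_⟩
  -- ### the representative `Φ` of `ψ`
  set Φ : E4 → ℝ := Function.extend Subtype.val ψ 0 with hΦ_def
  have hrep : ∀ y : (Kerr.exterior M a), ψ y = Φ y :=
    fun y ↦ (Subtype.val_injective.extend_apply _ _ y).symm
  have hΦat : ∀ x : E4, x ∈ (Kerr.exterior M a) → ContDiffAt ℝ ∞ Φ x := fun x hx ↦
    (OpensChart.contMDiffAt_iff ⟨x, hx⟩ ψ Φ hrep).mp (hψ ⟨x, hx⟩)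
  have hΦ2 : ∀ x : E4, x ∈ (Kerr.exterior M a) → ContDiffAt ℝ 2 Φ x := fun x hx ↦
    (hΦat x hx).of_le (ENat.natCast_le_of_coe_top_le_withTop le_rfl 2)
  have hΦon1 : ContDiffOn ℝ 1 Φ ((Kerr.exterior M a) : Set E4) := fun x hx ↦
    ((hΦat x hx).of_le (ENat.natCast_le_of_coe_top_le_withTop le_rfl 1)).contDiffWithinAt
  have hΦon2 : ContDiffOn ℝ 2 Φ ((Kerr.exterior M a) : Set E4) := fun x hx ↦
    (hΦ2 x hx).contDiffWithinAt
  -- ### the interpolating family of heights `F_θ = F₁ + κ(θ) G`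
  set G : E3 → ℝ := fun y ↦ F₂ y - F₁ y with hG_def
  have hG : ContDiff ℝ 1 G := hF₂.sub hF₁
  have hG0 : ∀ y, 0 ≤ G y := fun y ↦ sub_nonneg.mpr (hle y)
  have hGR : ∀ y : E3, ‖y‖ ≤ R' → G y = 0 := fun y hy ↦ by
    simp only [hG_def, hagree y hy, sub_self]
  have hF₁d : ∀ y, DifferentiableAt ℝ F₁ y := fun y ↦ hF₁.differentiable one_ne_zero y
  have hF₂d : ∀ y, DifferentiableAt ℝ F₂ y := fun y ↦ hF₂.differentiable one_ne_zero y
  have hGd : ∀ y, DifferentiableAt ℝ G y := fun y ↦ hG.differentiable one_ne_zero y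
  set κ : ℝ → ℝ := Real.smoothTransition with hκ_def
  have hκd : ∀ θ, HasDerivAt κ (deriv κ θ) θ := fun θ ↦
    ((Real.smoothTransition.contDiff (n := 1)).differentiable one_ne_zero θ).hasDerivAt
  have hκ01 : ∀ θ, 0 ≤ κ θ ∧ κ θ ≤ 1 := fun θ ↦
    ⟨Real.smoothTransition.nonneg θ, Real.smoothTransition.le_one θ⟩
  obtain ⟨Kκ, hKκ0, hKκ⟩ := Kerr.exists_bound_deriv_smoothTransition
  -- slope bound of the interpolated heights
  have hdFc : ∀ ϑ : ℝ, 0 ≤ ϑ → ϑ ≤ 1 → ∀ y,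
      ‖fderiv ℝ (fun y ↦ F₁ y + ϑ * G y) y‖ ≤ 1 - c := fun ϑ hϑ0 hϑ1 y ↦
    Kerr.norm_fderiv_interpolate_le (hF₁d y) (hF₂d y) hϑ0 hϑ1 (hdF₁ y) (hdF₂ y)
  -- ### vanishing far out: `dΦ = 0` at the graph points of the family over `‖y‖ ≥ ρ'`
  obtain ⟨ρ, hρ⟩ := hvan
  set ρ' : ℝ := max (max ρ R') 0 with hρ'_def
  have hρ'ρ : ρ ≤ ρ' := (le_max_left _ _).trans (le_max_left _ _)
  have hρ'R : R' ≤ ρ' := (le_max_right _ _).trans (le_max_left _ _)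
  have hρ'0 : 0 ≤ ρ' := le_max_right _ _
  have hvan' : ∀ ϑ : ℝ, 0 ≤ ϑ → ϑ ≤ 1 → ∀ y : E3, ρ' ≤ ‖y‖ →
      fderiv ℝ Φ (E4.ofTimeSpace (τ + (F₁ y + ϑ * G y)) y) = 0 := by
    intro ϑ hϑ0 hϑ1 y hy
    have hyR : R' ≤ ‖y‖ := hρ'R.trans hy
    have hx : E4.ofTimeSpace (τ + (F₁ y + ϑ * G y)) y ∈ (Kerr.exterior M a) := hmemU _ y hyR
    have h := hρ ⟨_, hx⟩ ?_ ?_ ?_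
    · exact Kerr.fderiv_extend_eq_zero (by simp) hψ ⟨_, hx⟩ h.2
    · show τ + F₁ (E4.spatial (E4.ofTimeSpace _ y)) ≤ (E4.ofTimeSpace _ y) 0
      rw [E4.spatial_ofTimeSpace, E4.ofTimeSpace_apply_zero]
      nlinarith [hG0 y]
    · show (E4.ofTimeSpace _ y) 0 ≤ τ + F₂ (E4.spatial (E4.ofTimeSpace _ y))
      rw [E4.spatial_ofTimeSpace, E4.ofTimeSpace_apply_zero]
      have : G y = F₂ y - F₁ y := rfl
      nlinarith [hG0 y]
    · show ρ ≤ E4.spatialNorm (E4.ofTimeSpace _ y)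
      rw [E4.spatialNorm_ofTimeSpace]; exact hρ'ρ.trans hy
  -- ### the flux density family `f θ`, its explicit `θ`-derivative `f' θ`, the far region `S`
  set S : Set E3 := {y | R' < ‖y‖} with hS_def
  set T : Set E3 := {y | R' ≤ ‖y‖} with hT_def
  have hS_meas : MeasurableSet S := (isOpen_lt continuous_const continuous_norm).measurableSet
  have hT_closed : IsClosed T := isClosed_le continuous_const continuous_norm
  have hST : S ⊆ T := fun y (hy : R' < ‖y‖) ↦ (hy.le : R' ≤ ‖y‖)
  obtain ⟨f, hf⟩ : ∃ f : ℝ → E3 → ℝ,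
      f = fun θ y ↦ Kerr.graphFluxDensity M a (fun y ↦ F₁ y + κ θ * G y) Φ τ y := ⟨_, rfl⟩
  obtain ⟨f', hf'⟩ : ∃ f' : ℝ → E3 → ℝ,
      f' = fun θ y ↦ Kerr.graphFluxDeriv M a Φ F₁ G τ (κ θ) (deriv κ θ) y := ⟨_, rfl⟩
  -- continuity of `f θ` on `T`
  have hf_cont : ∀ θ, ContinuousOn (f θ) T := fun θ ↦ by
    rw [hf]
    exact Kerr.continuousOn_graphFluxDensity M a (Kerr.exterior M a).isOpen hΦon1 hUr
      (hF₁.add (contDiff_const.mul hG)) τ (fun y hy ↦ hmemU _ y hy)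
  -- vanishing of `f θ` and `f' θ` over `‖y‖ ≥ ρ'`
  have hf_zero : ∀ θ (y : E3), ρ' ≤ ‖y‖ → f θ y = 0 := fun θ y hy ↦ by
    rw [hf]
    exact Kerr.graphFluxDensity_eq_zero_of_fderiv_eq_zero M a
      (hvan' (κ θ) (hκ01 θ).1 (hκ01 θ).2 y hy)
  have hf'_zero : ∀ θ (y : E3), ρ' ≤ ‖y‖ → f' θ y = 0 := fun θ y hy ↦ by
    rw [hf']
    have hx := hmemU (τ + (F₁ y + κ θ * G y)) y (hρ'R.trans hy)
    exact Kerr.graphFluxDeriv_eq_zero_of_fderiv_eq_zero M a (hΦ2 _ hx) (hUr _ hx)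
      (hvan' (κ θ) (hκ01 θ).1 (hκ01 θ).2 y hy)
  -- integrability of `f θ` on `S`
  have hf_int : ∀ θ, IntegrableOn (f θ) S volume := fun θ ↦
    integrableOn_far_of_continuousOn_of_eq_zero (hf_cont θ) (hf_zero θ)
  -- differentiability of the current at graph points over `T`
  have hJd : ∀ (t : ℝ) (y : E3), R' ≤ ‖y‖ → ∀ ν,
      DifferentiableAt ℝ (fun x ↦ Kerr.tCurrent M a Φ x ν) (E4.ofTimeSpace t y) := by
    intro t y hy ν
    have hx := hmemU t y hy
    have h2 : ContDiffAt ℝ ((1 : ℕ∞) + 1 : ℕ∞) Φ (E4.ofTimeSpace t y) := by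
      exact_mod_cast hΦ2 _ hx
    exact (Kerr.contDiffAt_tCurrent M a h2 (hUr _ hx) ν).differentiableAt one_ne_zero
  -- ### the flux `Flux θ = ∫_S f θ` and its derivative
  obtain ⟨Flux, hFlux⟩ : ∃ Flux : ℝ → ℝ, Flux = fun θ ↦ ∫ y in S, f θ y := ⟨_, rfl⟩
  have hFlux_deriv : ∀ θ₀, HasDerivAt Flux (∫ y in S, f' θ₀ y) θ₀ := by
    intro θ₀
    have hT'c : IsCompact (T ∩ Metric.closedBall (0 : E3) ρ') :=
      (isCompact_closedBall _ _).inter_left hT_closed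
    obtain ⟨C, hC⟩ := Kerr.exists_bound_graphFluxDeriv M a (Kerr.exterior M a).isOpen hΦon2 hUr
      hF₁ hG hT'c τ Kκ (fun _ _ y hy ↦ hmemU _ y hy.1)
    have hbound_int : Integrable
        ((Metric.closedBall (0 : E3) ρ').indicator fun _ ↦ max C 0) (volume.restrict S) := by
      refine Integrable.restrict ?_
      rw [integrable_indicator_iff measurableSet_closedBall]
      exact integrableOn_const (measure_closedBall_lt_top.ne)
    have key := hasDerivAt_integral_of_dominated_loc_of_deriv_le (μ := volume.restrict S)
      (F := f) (F' := f') (x₀ := θ₀) (s := Metric.ball θ₀ 1)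
      (bound := (Metric.closedBall (0 : E3) ρ').indicator fun _ ↦ max C 0)
      (Metric.ball_mem_nhds θ₀ one_pos) ?_ (hf_int θ₀) ?_ ?_ hbound_int ?_
    · rw [hFlux]; exact key.2
    · exact Filter.Eventually.of_forall fun θ ↦
        ((hf_cont θ).mono hST).aestronglyMeasurable hS_meas
    · -- `f' θ₀` is continuous on `T`
      have hcn := Kerr.continuousOn_graphFluxDeriv M a (Kerr.exterior M a).isOpen hΦon2 hUr hF₁
        hG τ (T := T) (fun _ _ y hy ↦ hmemU _ y hy)
      have hι : Continuous fun y : E3 ↦ ((κ θ₀, deriv κ θ₀, y) : ℝ × ℝ × E3) :=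
        continuous_const.prodMk (continuous_const.prodMk continuous_id)
      have hmaps : Set.MapsTo (fun y : E3 ↦ ((κ θ₀, deriv κ θ₀, y) : ℝ × ℝ × E3)) T
          (Set.Icc 0 1 ×ˢ Set.univ ×ˢ T) := fun y hy ↦
        ⟨⟨(hκ01 θ₀).1, (hκ01 θ₀).2⟩, Set.mem_univ _, hy⟩
      have hc' : ContinuousOn (f' θ₀) T := by
        rw [hf']
        exact hcn.comp hι.continuousOn hmaps
      exact (hc'.mono hST).aestronglyMeasurable hS_meas
    · refine (ae_restrict_mem hS_meas).mono fun y hy θ _ ↦ ?_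
      by_cases hyρ : ‖y‖ ≤ ρ'
      · have hyB : y ∈ Metric.closedBall (0 : E3) ρ' := by
          simpa only [Metric.mem_closedBall, dist_zero_right] using hyρ
        rw [Set.indicator_of_mem hyB, Real.norm_eq_abs, hf']
        have hk : deriv κ θ ∈ Set.Icc (-Kκ) Kκ := abs_le.mp (hKκ θ)
        exact (hC (κ θ) ⟨(hκ01 θ).1, (hκ01 θ).2⟩ (deriv κ θ) hk y ⟨hST hy, hyB⟩).trans
          (le_max_left _ _)
      · rw [hf'_zero θ y (le_of_not_ge hyρ), norm_zero]
        exact Set.indicator_nonneg (fun _ _ ↦ le_max_right _ _) y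
    · refine (ae_restrict_mem hS_meas).mono fun y hy θ _ ↦ ?_
      rw [hf, hf']
      exact Kerr.hasDerivAt_graphFluxDensity M a Φ F₁ G (hκd θ) τ y (hF₁d y) (hGd y)
        (hJd _ y (hST hy))
  -- ### the derivative of the flux vanishes: divergence identity + integration by parts
  have hFlux_zero : ∀ θ, ∫ y in S, f' θ y = 0 := by
    intro θ
    set cθ : ℝ := κ θ with hcθ_def
    set k : ℝ := deriv κ θ with hk_def
    -- the graph map, the spatial components of the current along it, the domain `Ω`
    obtain ⟨P, hP⟩ : ∃ P : E3 → E4, P = fun y ↦ E4.ofTimeSpace (τ + (F₁ y + cθ * G y)) y :=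
      ⟨_, rfl⟩
    have hPd : ∀ y, DifferentiableAt ℝ P y := fun y ↦ by
      rw [hP]
      exact (E4.hasFDerivAt_graphMap (F := fun y ↦ F₁ y + cθ * G y)
        ((hF₁d y).add ((hGd y).const_mul cθ)).hasFDerivAt τ).differentiableAt
    have hP1 : ContDiff ℝ 1 P := by
      rw [hP]; exact Kerr.contDiff_graphMap (hF₁.add (contDiff_const.mul hG)) τ
    have hPU : ∀ y : E3, R' ≤ ‖y‖ → P y ∈ (Kerr.exterior M a) := fun y hy ↦ by
      rw [hP]; exact hmemU _ y hy
    set Ω : Set E3 := (Kerr.slice a (Kerr.rPlus M a) : Set E3) with hΩ_def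
    have hΩ : IsOpen Ω := (Kerr.slice a (Kerr.rPlus M a)).isOpen
    have hTΩ : T ⊆ Ω := fun y hy ↦
      Kerr.mem_slice_of_le_norm_of_two_mul_scalarH_le hMa hc hsliceR hHR hy
    have hPΩ : ∀ y ∈ Ω, P y ∈ (Kerr.exterior M a) := fun y hy ↦ by
      rw [hP]; exact Kerr.ofTimeSpace_mem_exterior_iff.mpr hy
    obtain ⟨V, hV⟩ : ∃ V : Fin 3 → E3 → ℝ, V = fun i y ↦ Kerr.tCurrent M a Φ (P y) i.succ :=
      ⟨_, rfl⟩
    have hV1 : ∀ i, ContDiffOn ℝ 1 (V i) Ω := by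
      intro i y hy
      have hyU := hPΩ y hy
      have h2 : ContDiffAt ℝ ((1 : ℕ∞) + 1 : ℕ∞) Φ (P y) := by exact_mod_cast hΦ2 _ hyU
      have hJ : ContDiffAt ℝ (1 : ℕ∞) (fun x ↦ Kerr.tCurrent M a Φ x i.succ) (P y) :=
        Kerr.contDiffAt_tCurrent M a h2 (hUr _ hyU) i.succ
      rw [hV]
      exact (hJ.comp y hP1.contDiffAt).contDiffWithinAt
    -- the cutoff `χ = 1` on `closedBall 0 (ρ' + 1)` and the test function `g = k G χ`
    let χ : ContDiffBump (0 : E3) := ⟨ρ' + 1, ρ' + 2, by linarith, by linarith⟩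
    obtain ⟨g, hg⟩ : ∃ g : E3 → ℝ, g = fun y ↦ k * G y * χ y := ⟨_, rfl⟩
    have hg1 : ContDiff ℝ 1 g := by rw [hg]; exact (contDiff_const.mul hG).mul χ.contDiff
    have hgd : ∀ y, DifferentiableAt ℝ g y := fun y ↦ hg1.differentiable one_ne_zero y
    have hgc : HasCompactSupport g := by rw [hg]; exact χ.hasCompactSupport.mul_left
    have hG_tsupp : tsupport G ⊆ T := by
      refine closure_minimal (fun y hy ↦ ?_) hT_closed
      by_contra hyT
      exact hy (hGR y (le_of_not_ge hyT))
    have hg_tsupp : tsupport g ⊆ Ω := by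
      rw [hg]
      refine (tsupport_mul_subset_left.trans ?_).trans (hG_tsupp.trans hTΩ)
      exact tsupport_mul_subset_right
    -- integration by parts, summed over `i`
    have hibp := fun i ↦ integral_fderiv_mul_add_mul_fderiv_eq_zero hΩ (hV1 i) hg1 hgc hg_tsupp i
    obtain ⟨w, hw⟩ : ∃ w : E3 → ℝ, w = fun y ↦ ∑ i : Fin 3,
        (fderiv ℝ (V i) y (EuclideanSpace.single i 1) * g y +
          V i y * fderiv ℝ g y (EuclideanSpace.single i 1)) := ⟨_, rfl⟩
    have hw_int : ∫ y, w y = 0 := by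
      rw [hw, integral_finsetSum _ fun i _ ↦ (hibp i).1]
      exact Finset.sum_eq_zero fun i _ ↦ (hibp i).2
    -- `w = f' θ` on `S`
    have hw_S : ∀ y ∈ S, f' θ y = w y := by
      intro y hy
      have hyT : R' ≤ ‖y‖ := hST hy
      by_cases hyρ : ρ' + 1 ≤ ‖y‖
      · -- far out both sides vanish
        have hy' : ρ' ≤ ‖y‖ := by linarith
        have hdΦ : fderiv ℝ Φ (P y) = 0 := by
          rw [hP]; exact hvan' cθ (hκ01 θ).1 (hκ01 θ).2 y hy'
        have hyU := hPU y hyT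
        have hV0 : ∀ i, V i y = 0 := fun i ↦ by
          rw [hV]; exact Kerr.tCurrent_eq_zero_of_fderiv_eq_zero M a hdΦ _
        have hdV0 : ∀ i, fderiv ℝ (V i) y = 0 := by
          intro i
          have hJd' : DifferentiableAt ℝ (fun x ↦ Kerr.tCurrent M a Φ x i.succ) (P y) := by
            rw [hP]; exact hJd _ y hyT i.succ
          have hVi : V i = (fun x ↦ Kerr.tCurrent M a Φ x i.succ) ∘ P := by rw [hV]; rfl
          rw [hVi, fderiv_comp y hJd' (hPd y),
            Kerr.fderiv_tCurrent_eq_zero_of_fderiv_eq_zero M a (hΦ2 _ hyU) (hUr _ hyU) hdΦ,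
            ContinuousLinearMap.zero_comp]
        rw [hf'_zero θ y hy', hw]
        simp [hV0, hdV0]
      · push Not at hyρ
        -- near: `g = k G` near `y`, product rule, and `∑_μ ∂_μ J^μ = 0`
        have hχ1 : ∀ᶠ z in 𝓝 y, χ z = 1 := by
          have : Metric.ball (0 : E3) (ρ' + 1) ∈ 𝓝 y :=
            Metric.isOpen_ball.mem_nhds (by simpa only [Metric.mem_ball, dist_zero_right])
          filter_upwards [this] with z hz
          exact χ.one_of_mem_closedBall (Metric.ball_subset_closedBall hz)
        have hg_ev : (fun z ↦ k * G z) =ᶠ[𝓝 y] g := by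
          filter_upwards [hχ1] with z hz
          rw [hg]; simp only [hz, mul_one]
        have hyU := hPU y hyT
        have hJdy : ∀ ν, DifferentiableAt ℝ (fun x ↦ Kerr.tCurrent M a Φ x ν)
            (E4.ofTimeSpace (τ + (F₁ y + cθ * G y)) y) := hJd _ y hyT
        have hdiv : ∑ μ, fderiv ℝ (fun x ↦ Kerr.tCurrent M a Φ x μ)
            (E4.ofTimeSpace (τ + (F₁ y + cθ * G y)) y) (E4.basisVector μ) = 0 :=
          Kerr.sum_fderiv_tCurrent_eq_zero M a (Kerr.rPlus M a) hrep ⟨_, hmemU _ y hyT⟩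
            (hΦ2 _ (hmemU _ y hyT)) (hsol _)
        have e1 : f' θ y = ∑ i : Fin 3, fderiv ℝ (fun y ↦ V i y * (k * G y)) y
            (EuclideanSpace.single i 1) := by
          rw [hf', hV]
          show Kerr.graphFluxDeriv M a Φ F₁ G τ cθ k y = _
          rw [Kerr.graphFluxDeriv_eq M a Φ F₁ G τ cθ k y (hF₁d y) (hGd y) hJdy, hdiv, mul_zero,
            sub_zero, hP]
        rw [e1, hw]
        refine Finset.sum_congr rfl fun i _ ↦ ?_
        have hVd : DifferentiableAt ℝ (V i) y :=
          ((hV1 i).differentiableOn one_ne_zero y (hTΩ hyT)).differentiableAt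
            (hΩ.mem_nhds (hTΩ hyT))
        have hev : (fun z ↦ V i z * (k * G z)) =ᶠ[𝓝 y] fun z ↦ V i z * g z := by
          filter_upwards [hg_ev] with z hz
          rw [hz]
        rw [hev.fderiv_eq, fderiv_fun_mul hVd (hgd y)]
        simp only [add_apply, FunLike.coe_smul, Pi.smul_apply, smul_eq_mul]
        ring
    -- `w = 0` off `S`
    have hw_Sc : ∀ y, y ∉ S → w y = 0 := by
      intro y hy
      have hyR : ‖y‖ ≤ R' := not_lt.mp hy
      have hGy : G y = 0 := hGR y hyR
      have hdGy : fderiv ℝ G y = 0 := by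
        have hmin : IsLocalMin G y :=
          Filter.Eventually.of_forall fun z ↦ (by rw [hGy]; exact hG0 z : G y ≤ G z)
        exact hmin.fderiv_eq_zero
      have hgy : g y = 0 := by rw [hg]; simp [hGy]
      have hdgy : fderiv ℝ g y = 0 := by
        have h1 : DifferentiableAt ℝ (fun z ↦ k * G z) y := (hGd y).const_mul k
        have h2 : DifferentiableAt ℝ (fun z ↦ (χ : E3 → ℝ) z) y :=
          χ.contDiff.differentiable one_ne_zero y
        rw [hg, fderiv_fun_mul h1 h2, fderiv_const_mul (hGd y), hdGy, hGy]
        simp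
      rw [hw]
      simp [hgy, hdgy]
    -- conclusion
    calc ∫ y in S, f' θ y = ∫ y in S, w y := setIntegral_congr_fun hS_meas hw_S
      _ = ∫ y, w y := setIntegral_eq_integral_of_forall_compl_eq_zero hw_Sc
      _ = 0 := hw_int
  -- ### the flux is constant in `θ`
  have hFlux_const : Flux 0 = Flux 1 := by
    have hd : ∀ θ, HasDerivAt Flux 0 θ := fun θ ↦ by simpa [hFlux_zero θ] using hFlux_deriv θ
    exact is_const_of_deriv_eq_zero (fun θ ↦ (hd θ).differentiableAt) (fun θ ↦ (hd θ).deriv) 0 1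
  -- ### comparison of flux densities and energy densities on `S`
  have hbounds : ∀ F : E3 → ℝ, (∀ y, ‖fderiv ℝ F y‖ ≤ 1 - c) → ∀ y ∈ S,
      c / 6 * coordEnergyDensity (Kerr.exterior M a) ψ (E4.ofTimeSpace (τ + F y) y) ≤
          Kerr.graphFluxDensity M a F Φ τ y ∧
        Kerr.graphFluxDensity M a F Φ τ y ≤
          7 / 2 * coordEnergyDensity (Kerr.exterior M a) ψ (E4.ofTimeSpace (τ + F y) y) := by
    intro F hdF y hy
    have h := Kerr.graphFluxDensity_bounds_of_le hM.le a F Φ τ y hc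
      (hUr _ (hmemU _ y (hST hy))) (hH _ y (hST hy)) (hdF y)
    rwa [Kerr.sum_sq_fderiv_extend_eq] at h
  have hE : ∀ F : E3 → ℝ, graphSliceEnergyOn (Kerr.exterior M a) ψ F τ S =
      ∫⁻ y in S, ENNReal.ofReal
        (coordEnergyDensity (Kerr.exterior M a) ψ (E4.ofTimeSpace (τ + F y) y)) := by
    intro F
    unfold graphSliceEnergyOn
    refine setLIntegral_congr_fun hS_meas fun y hy ↦ ?_
    rw [Set.indicator_of_mem]
    exact hmemU _ y (hST hy)
  have hA_le : ∀ F : E3 → ℝ, (∀ y, ‖fderiv ℝ F y‖ ≤ 1 - c) →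
      (∫⁻ y in S, ENNReal.ofReal (Kerr.graphFluxDensity M a F Φ τ y)) ≤
        K₂ * graphSliceEnergyOn (Kerr.exterior M a) ψ F τ S := by
    intro F hdF
    rw [hE F, ← lintegral_const_mul' _ _ ENNReal.ofReal_ne_top]
    refine setLIntegral_mono' hS_meas fun y hy ↦ ?_
    rw [← ENNReal.ofReal_mul (by norm_num)]
    exact ENNReal.ofReal_le_ofReal (hbounds F hdF y hy).2
  have hE_le : ∀ F : E3 → ℝ, (∀ y, ‖fderiv ℝ F y‖ ≤ 1 - c) →
      graphSliceEnergyOn (Kerr.exterior M a) ψ F τ S ≤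
        K₁ * ∫⁻ y in S, ENNReal.ofReal (Kerr.graphFluxDensity M a F Φ τ y) := by
    intro F hdF
    rw [hE F, ← lintegral_const_mul' _ _ ENNReal.ofReal_ne_top]
    refine setLIntegral_mono' hS_meas fun y hy ↦ ?_
    rw [← ENNReal.ofReal_mul (by positivity)]
    refine ENNReal.ofReal_le_ofReal ?_
    have h1 := (hbounds F hdF y hy).1
    calc coordEnergyDensity (Kerr.exterior M a) ψ (E4.ofTimeSpace (τ + F y) y)
        = 6 / c * (c / 6 *
            coordEnergyDensity (Kerr.exterior M a) ψ (E4.ofTimeSpace (τ + F y) y)) := by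
          field_simp
      _ ≤ 6 / c * Kerr.graphFluxDensity M a F Φ τ y := mul_le_mul_of_nonneg_left h1 (by positivity)
  -- the `lintegral` of the flux density is `ofReal` of the flux
  have hA_eq : ∀ θ, (∫⁻ y in S, ENNReal.ofReal (f θ y)) = ENNReal.ofReal (Flux θ) := by
    intro θ
    rw [hFlux, ofReal_integral_eq_lintegral_ofReal (hf_int θ)]
    refine (ae_restrict_mem hS_meas).mono fun y hy ↦ ?_
    have hb := (hbounds (fun y ↦ F₁ y + κ θ * G y) (hdFc (κ θ) (hκ01 θ).1 (hκ01 θ).2) y hy).1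
    rw [hf]
    exact le_trans (mul_nonneg (by positivity) (coordEnergyDensity_nonneg _ _ _)) hb
  have hf0 : ∀ y, f 0 y = Kerr.graphFluxDensity M a F₁ Φ τ y := fun y ↦ by
    rw [hf]
    simp only [hκ_def, Real.smoothTransition.zero_of_nonpos le_rfl, zero_mul, add_zero]
  have hf1 : ∀ y, f 1 y = Kerr.graphFluxDensity M a F₂ Φ τ y := fun y ↦ by
    rw [hf]
    simp only [hκ_def, Real.smoothTransition.one_of_one_le le_rfl, one_mul, hG_def,
      add_sub_cancel]
  have hA0 : (∫⁻ y in S, ENNReal.ofReal (Kerr.graphFluxDensity M a F₁ Φ τ y)) =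
      ENNReal.ofReal (Flux 0) := by
    rw [← hA_eq 0]; simp only [hf0]
  have hA1 : (∫⁻ y in S, ENNReal.ofReal (Kerr.graphFluxDensity M a F₂ Φ τ y)) =
      ENNReal.ofReal (Flux 1) := by
    rw [← hA_eq 1]; simp only [hf1]
  -- ### conclusion
  constructor
  · calc graphSliceEnergyOn (Kerr.exterior M a) ψ F₂ τ S
        ≤ K₁ * ∫⁻ y in S, ENNReal.ofReal (Kerr.graphFluxDensity M a F₂ Φ τ y) := hE_le F₂ hdF₂
      _ = K₁ * ∫⁻ y in S, ENNReal.ofReal (Kerr.graphFluxDensity M a F₁ Φ τ y) := by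
          rw [hA1, hA0, hFlux_const]
      _ ≤ K₁ * (K₂ * graphSliceEnergyOn (Kerr.exterior M a) ψ F₁ τ S) := by
          gcongr; exact hA_le F₁ hdF₁
      _ = K₁ * K₂ * graphSliceEnergyOn (Kerr.exterior M a) ψ F₁ τ S := by rw [mul_assoc]
  · calc graphSliceEnergyOn (Kerr.exterior M a) ψ F₁ τ S
        ≤ K₁ * ∫⁻ y in S, ENNReal.ofReal (Kerr.graphFluxDensity M a F₁ Φ τ y) := hE_le F₁ hdF₁
      _ = K₁ * ∫⁻ y in S, ENNReal.ofReal (Kerr.graphFluxDensity M a F₂ Φ τ y) := by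
          rw [hA1, hA0, hFlux_const]
      _ ≤ K₁ * (K₂ * graphSliceEnergyOn (Kerr.exterior M a) ψ F₂ τ S) := by
          gcongr; exact hA_le F₂ hdF₂
      _ = K₁ * K₂ * graphSliceEnergyOn (Kerr.exterior M a) ψ F₂ τ S := by rw [mul_assoc]

end Literature.Geometry.Lorentzian

end
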